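import Summits.MatrixMultiplication.OmegaCensus.SmallFormats.MatMul227GF3EnumSound
import Summits.MatrixMultiplication.OmegaCensus.SmallFormats.MatMul227GF3EnumCases
import HarnessLib

/-!
# ω-census family (a): kernel `(henum)` at `(7,23)` — symmetry reductions and the enumeration of count vectors

Cell `pub-omega` (unit `pub-omega-tensor`, gen 31), topic `Summits/MatrixMultiplication/OmegaCensus`
(sub-folder `SmallFormats`). Framing (verbatim): lottery ticket; floor = certified bounds/negative ranges.
HONEST FRAMING: bookkeeping — part 9 of 12 of the KERNEL proof of the ENUMERATION hypothesis `(henum)` of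
`twentyfour_le_tensorRank_227_gf3_of_enumeration` (`MatMul22nGF3MarginalCensus`) for the six-orbit list of the
`𝔽₃` `⟨2,2,7⟩@23` X-marginal census (desk-certified ×3 before: ENUM-X2 §6/§8). The EXCLUSION hypothesis `(hexcl)`
stays engine-side (Pa17: two code-disjoint exact engines; the IP instrument); nothing here is a bound on `ω`, and no
sentence here is 'R_𝔽₃(⟨2,2,7⟩) ≥ 24'.

The symmetry group on count vectors (`actS`, `actWS`, words, inverse words), invariance of admissibility under the
five generators (clause-table permutations, by `decide`), the WLOG chain — translate an invertible class to `I`; no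
invertible class occurs twice (case `I`); conjugate the second class to `κ₀ / γ₀ / τ₀` (cases `kappa`, `gamma`,
`tau`); only double transpositions left ⇒ `b ≤ 4 < 7` — and the assembled theorem `enum_of_runs`: given the kernel
searches, every admissible count vector is a word image of one of the three representatives.
-/

namespace Summit.MatrixMultiplication.OmegaCensus.SmallFormats.Enum723

set_option maxRecDepth 4000

open Finset

/-! ## The symmetry group on count vectors -/

/-- Source map of generator `s`: `gsrc s b` is the class carried to `b`. -/
def gsrc (s b : ℕ) : ℕ := (gsrcL.getD s []).getD b 0

/-- Forward map of generator `s`. -/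
def gfwd (s a : ℕ) : ℕ := (gfwdL.getD s []).getD a 0

/-- Inverse clause permutation of generator `s`. -/
def kinv (s k : ℕ) : ℕ := (kinvL.getD s []).getD k 0

/-- Inverse generator. -/
def ginv (s : ℕ) : ℕ := ginvL.getD s 0

/-- Action of generator `s` on count vectors (as functions): `(actS s c) b = c (gsrc s b)`. -/
def actS (s : ℕ) (c : ℕ → ℕ) : ℕ → ℕ := fun b => c (gsrc s b)

/-- Action of a word (generators applied left to right). -/
def actWS : List ℕ → (ℕ → ℕ) → ℕ → ℕ
  | [], c => c
  | s :: w, c => actWS w (actS s c)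

/-- Source map of a word: `actWS w c b = c (srcW w b)`. -/
def srcW : List ℕ → ℕ → ℕ
  | [], b => b
  | s :: w, b => gsrc s (srcW w b)

/-- The inverse word. -/
def invW (w : List ℕ) : List ℕ := (w.map ginv).reverse

/-- A word uses only the five generators. -/
def WordOK (w : List ℕ) : Prop := ∀ s ∈ w, s < 5

/-- Decidability by the Boolean test. -/
instance (w : List ℕ) : Decidable (WordOK w) := inferInstanceAs (Decidable (∀ s ∈ w, s < 5))

/-- Equality of count vectors on the 40 classes. -/
def Eq40 (f g : ℕ → ℕ) : Prop := ∀ b, b < 40 → f b = g b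

/-- Representative `j` as a count vector. -/
def repv (j : ℕ) : ℕ → ℕ := fun b => (repcL.getD j []).getD b 0

/-! ### Table facts about the generators (by `decide`) -/

/-- The generator tables are permutations of the 40 classes, with the listed inverses. -/
theorem gen_perm : ∀ s, s < 5 → (gsrcL.getD s []).length = 40 ∧ ginv s < 5 ∧ ∀ b, b < 40 →
    gsrc s b < 40 ∧ gfwd s b < 40 ∧ gfwd s (gsrc s b) = b ∧ gsrc s (gfwd s b) = b ∧
      gsrc s (gsrc (ginv s) b) = b := by
  decide +kernel

/-- The generators permute the clause table (with caps): `inc (g a) k = inc a (kinv k)`. -/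
theorem gen_clause : ∀ s, s < 5 → ∀ k, k < 82 → kinv s k < 82 ∧ cap (kinv s k) = cap k ∧
    ∀ a, a < 40 → inc (gfwd s a) k = inc a (kinv s k) := by
  decide +kernel

/-- The three representatives have 40 digits. -/
theorem repcL_length : ∀ j, j < 3 → (repcL.getD j []).length = 40 := by decide

/-! ### Basic properties of the action -/

/-- A word acts through its source map. -/
theorem actWS_apply : ∀ (w : List ℕ) (c : ℕ → ℕ) (b : ℕ), actWS w c b = c (srcW w b)
  | [], _, _ => rfl
  | s :: w, c, b => by rw [actWS, actWS_apply w, srcW]; rfl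

/-- Source maps of words stay below `40`. -/
theorem srcW_lt : ∀ (w : List ℕ), WordOK w → ∀ b, b < 40 → srcW w b < 40
  | [], _, b, hb => hb
  | s :: w, hw, b, hb => by
      rw [srcW]
      exact ((gen_perm s (hw s (by simp))).2.2 _ (srcW_lt w (fun t ht => hw t (by simp [ht])) b hb)).1

/-- Concatenated words act in sequence. -/
theorem actWS_append : ∀ (u v : List ℕ) (c : ℕ → ℕ), actWS (u ++ v) c = actWS v (actWS u c)
  | [], _, _ => rfl
  | s :: u, v, c => by rw [List.cons_append, actWS, actWS, actWS_append u v]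

/-- The word action only reads the 40 digits. -/
theorem actWS_congr : ∀ (w : List ℕ), WordOK w → ∀ {f g : ℕ → ℕ}, Eq40 f g → Eq40 (actWS w f) (actWS w g) := by
  intro w hw f g hfg b hb
  rw [actWS_apply, actWS_apply]
  exact hfg _ (srcW_lt w hw b hb)

/-- The inverse word uses only the five generators. -/
theorem wordOK_invW {w : List ℕ} (hw : WordOK w) : WordOK (invW w) := by
  intro s hs
  simp only [invW, List.mem_reverse, List.mem_map] at hs
  obtain ⟨t, ht, rfl⟩ := hs
  exact (gen_perm t (hw t ht)).2.1

/-- Concatenation of words in the generators. -/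
theorem wordOK_append {u v : List ℕ} (hu : WordOK u) (hv : WordOK v) : WordOK (u ++ v) := by
  intro s hs; rw [List.mem_append] at hs; exact hs.elim (hu s) (hv s)

/-- The inverse of `s :: w`. -/
theorem invW_cons (s : ℕ) (w : List ℕ) : invW (s :: w) = invW w ++ [ginv s] := by
  simp [invW]

/-- The inverse word undoes the word (on the 40 classes). -/
theorem actWS_invW : ∀ (w : List ℕ), WordOK w → ∀ (c : ℕ → ℕ), Eq40 (actWS (invW w) (actWS w c)) c
  | [], _, c => fun b _ => rfl
  | s :: w, hw, c => by
      have hs : s < 5 := hw s (by simp)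
      have hw' : WordOK w := fun t ht => hw t (by simp [ht])
      intro b hb
      rw [invW_cons, actWS_append, actWS]
      show actS (ginv s) (actWS (invW w) (actWS w (actS s c))) b = c b
      obtain ⟨-, hgi, hperm⟩ := gen_perm s hs
      have hb' : gsrc (ginv s) b < 40 := ((gen_perm _ hgi).2.2 b hb).1
      rw [actS, actWS_invW w hw' (actS s c) _ hb', actS, (hperm b hb).2.2.2.2]

/-! ### Invariance of admissibility -/

/-- Re-indexing a class sum along a generator. -/
theorem sum_reindex (s : ℕ) (hs : s < 5) (c G : ℕ → ℕ) :
    ∑ b ∈ range 40, c (gsrc s b) * G b = ∑ a ∈ range 40, c a * G (gfwd s a) := by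
  have hp := (gen_perm s hs).2.2
  refine Finset.sum_nbij' (gsrc s) (gfwd s) (fun b hb => ?_) (fun a ha => ?_) (fun b hb => ?_)
    (fun a ha => ?_) (fun b hb => ?_)
  · exact Finset.mem_range.mpr (hp b (Finset.mem_range.mp hb)).1
  · exact Finset.mem_range.mpr (hp a (Finset.mem_range.mp ha)).2.1
  · exact (hp b (Finset.mem_range.mp hb)).2.2.1
  · exact (hp a (Finset.mem_range.mp ha)).2.2.2.1
  · rw [(hp b (Finset.mem_range.mp hb)).2.2.1]

/-- A generator maps admissible count vectors to admissible count vectors. -/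
theorem adm_actS (s : ℕ) (hs : s < 5) {c : ℕ → ℕ} (h : Adm c) : Adm (actS s c) := by
  obtain ⟨hcap, hdig, htot⟩ := h
  refine ⟨fun k hk => ?_, fun b hb => ?_, ?_⟩
  · obtain ⟨hk', hcapk, hinc⟩ := gen_clause s hs k hk
    have : load (actS s c) k = load c (kinv s k) := by
      simp only [load, actS]
      rw [sum_reindex s hs c (fun b => inc b k)]
      exact Finset.sum_congr rfl fun a ha => by rw [hinc a (Finset.mem_range.mp ha)]
    rw [this, ← hcapk]; exact hcap _ hk'
  · exact hdig _ ((gen_perm s hs).2.2 b hb).1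
  · have := sum_reindex s hs c (fun _ => 1)
    simp only [mul_one] at this
    simp only [tot, actS]; rw [this]; exact htot

/-- Words preserve admissibility. -/
theorem adm_actWS (w : List ℕ) (hw : WordOK w) {c : ℕ → ℕ} (h : Adm c) : Adm (actWS w c) := by
  induction w generalizing c with
  | nil => exact h
  | cons s w ih => exact ih (fun t ht => hw t (by simp [ht])) (adm_actS s (hw s (by simp)) h)

/-- Admissibility only depends on the 40 digits. -/
theorem adm_congr {f g : ℕ → ℕ} (hfg : Eq40 f g) (h : Adm f) : Adm g := by
  obtain ⟨hcap, hdig, htot⟩ := h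
  have hl : ∀ k, load g k = load f k := fun k =>
    Finset.sum_congr rfl fun a ha => by rw [hfg a (Finset.mem_range.mp ha)]
  refine ⟨fun k hk => by rw [hl]; exact hcap k hk, fun a ha => by rw [← hfg a ha]; exact hdig a ha, ?_⟩
  rw [← htot]; exact Finset.sum_congr rfl fun a ha => (hfg a (Finset.mem_range.mp ha)).symm

/-! ### From list certificates to function certificates -/

/-- The list action of a generator returns 40 digits. -/
theorem actG_length (s : ℕ) (hs : s < 5) (v : List ℕ) : (actG s v).length = 40 := by
  rw [actG, List.length_map, (gen_perm s hs).1]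

/-- Entries of the list action of a generator. -/
theorem actG_getD (s : ℕ) (hs : s < 5) (v : List ℕ) (b : ℕ) (hb : b < 40) :
    (actG s v).getD b 0 = v.getD (gsrc s b) 0 := by
  have hl := (gen_perm s hs).1
  have hb' : b < (gsrcL.getD s []).length := by rw [hl]; exact hb
  rw [actG, gsrc, List.getD_eq_getElem?_getD, List.getElem?_map, List.getElem?_eq_getElem hb',
    List.getD_eq_getElem _ _ hb']
  rfl

/-- The list action agrees with the function action. -/
theorem actW_getD : ∀ (w : List ℕ), WordOK w → ∀ (v : List ℕ), v.length = 40 →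
    Eq40 (fun b => (actW w v).getD b 0) (actWS w fun t => v.getD t 0)
  | [], _, v, _ => fun b _ => rfl
  | s :: w, hw, v, hv => by
      have hs : s < 5 := hw s (by simp)
      have hw' : WordOK w := fun t ht => hw t (by simp [ht])
      intro b hb
      rw [actW, actWS, actW_getD w hw' (actG s v) (actG_length s hs v) b hb]
      exact actWS_congr w hw' (fun t ht => actG_getD s hs v t ht) b hb

end Summit.MatrixMultiplication.OmegaCensus.SmallFormats.Enum723
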